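import Literature.NumberTheory.LFunctions.KMVAfeWeightRealForm
import HarnessLib

/-!
# `𝒱_k(L) = ∫_0^∞ e^{−x}(L + log x)^k dx = Σ_i (k choose i) γ_{k−i} L^i`, `γ_j = ∫_0^∞ e^{−x} logʲx dx = Γ^{(j)}(1)`
# (helper for crux K_A `PrimeLevelFamEdge.MomentsBeyondDiagonal`, stmt-Parity-20007, stub `stub_first : SubFirst` ∀`Q`)

The complete diagonal weight of the order-`k` twisted first moment (`…FirstOrderMollifiedK`,
`harmonicSum_heckeLambda_mul_derivLambda_sub_complete_le`: main term `q̂^{1/2} m^{−1/2} 𝒱_k(log(q̂/m))`) is a polynomial of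
degree `k` in `L = log(q̂/m)` with the absolute constants `γ_j = ∫_0^∞ e^{−x}(log x)^j dx` (`γ_0 = 1`): binomial theorem under the
integral, each term integrable by the tree's `KMV2000.integrableOn_expLogPow`. With `…FirstOrderDiagExpansion.diagSum_expand` this
puts the order-`k` diagonal onto the weighted log-power sums `W_j(M)` of `KMVMollifierDiagonalMainTerm`.
Proof only; nothing about Landau–Siegel zeros; K_A NOT proved.
-/

noncomputable section

open scoped Real
open Set MeasureTheory Finset
open Literature.NumberTheory.LFunctions Literature.NumberTheory.LFunctions.KMV2000

namespace Summit.Parity.GeneralizedHardyLittlewood.Theorems.MomentsBeyondDiagonal.FirstOrderAFE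

/-- **`∫_0^∞ e^{−x}(log c + log x)^k dx = Σ_{i ≤ k} (k choose i) (log c)^i ∫_0^∞ e^{−x}(log x)^{k−i} dx`** (any real `c`).
[cite: KowalskiMichelVanderKam2000, §4 (14)–(16)] -/
theorem integral_expLogPow_eq_sum_choose (c : ℝ) (k : ℕ) :
    ∫ x in Ioi (0 : ℝ), Real.exp (-x) * (Real.log c + Real.log x) ^ k =
      ∑ i ∈ range (k + 1), ((k.choose i : ℕ) : ℝ) * (Real.log c) ^ i *
        ∫ x in Ioi (0 : ℝ), Real.exp (-x) * (Real.log x) ^ (k - i) := by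
  have hint : ∀ j : ℕ, IntegrableOn (fun x : ℝ ↦ Real.exp (-x) * (Real.log x) ^ j) (Ioi 0) := by
    intro j
    have h := integrableOn_expLogPow one_pos j
    simpa only [Real.log_one, zero_add] using h
  have hpt : ∀ x : ℝ, Real.exp (-x) * (Real.log c + Real.log x) ^ k =
      ∑ i ∈ range (k + 1), ((k.choose i : ℕ) : ℝ) * (Real.log c) ^ i * (Real.exp (-x) * (Real.log x) ^ (k - i)) := by
    intro x
    rw [add_pow, Finset.mul_sum]
    refine Finset.sum_congr rfl fun i _ ↦ ?_
    ring
  simp_rw [hpt]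
  rw [integral_finsetSum _ fun i _ ↦ ((hint (k - i)).const_mul _)]
  refine Finset.sum_congr rfl fun i _ ↦ ?_
  rw [integral_const_mul]

/-- `γ_0 = ∫_0^∞ e^{−x} dx = 1`. -/
theorem integral_exp_neg_logPow_zero : ∫ x in Ioi (0 : ℝ), Real.exp (-x) * (Real.log x) ^ 0 = 1 := by
  simp only [pow_zero, mul_one]
  exact integral_exp_neg_Ioi_zero

/-- The top coefficient: `𝒱_k(L) = L^k + Σ_{i < k} (k choose i) γ_{k−i} L^i` — the `i = k` term of
`integral_expLogPow_eq_sum_choose` is `(log c)^k`. -/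
theorem integral_expLogPow_eq_pow_add_sum (c : ℝ) (k : ℕ) :
    ∫ x in Ioi (0 : ℝ), Real.exp (-x) * (Real.log c + Real.log x) ^ k =
      (Real.log c) ^ k + ∑ i ∈ range k, ((k.choose i : ℕ) : ℝ) * (Real.log c) ^ i *
        ∫ x in Ioi (0 : ℝ), Real.exp (-x) * (Real.log x) ^ (k - i) := by
  rw [integral_expLogPow_eq_sum_choose c k, Finset.sum_range_succ, Nat.choose_self, Nat.sub_self,
    integral_exp_neg_logPow_zero]
  push_cast
  ring

end Summit.Parity.GeneralizedHardyLittlewood.Theorems.MomentsBeyondDiagonal.FirstOrderAFE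

end
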